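import Literature.Computability.Complexity.Randomized
import Literature.Computability.Complexity.TimeBoundsProofs
import Literature.Computability.Complexity.PairProjections
import HarnessLib

/-!
# Randomized algorithms: deterministic polynomial time is PPT (proofs; trunk CplxCore)

Sibling proof file of `Randomized.lean` (D-0014). Discharges its named fact
`RandAlg.IsPolyTime.ofDet` — "since a deterministic TM is a special case of a PTM, the class
**BPP** clearly contains **P**" (Arora–Barak 2009, §7.1, remark before Def. 7.3; in the
random-tape form of Def. 7.3: a polynomial-time `M(x)` is a polynomial-time `M(x, r)` ignoring
`r`). In the vendored model a randomized algorithm reads the pair `⟨x, r⟩ = boolPair (ea x) r`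
(`BoolEncodings.lean`), so the formal content is a re-encoding: from a machine computing `f`
on `ea x`, obtain one computing `f ∘ Prod.fst` on `boolPair (ea x) r`, in time polynomial in
`|boolPair (ea x) r| = 2|ea x| + 2 + |r|`. This is assembled from two discharged facts:

* `polyTimeComputable_fst_holds` (`PairProjections.lean`): the first projection of a
  `boolPair`-encoded pair of strings is polynomial time (a finite-state transducer halving the
  doubled prefix), transported here to arbitrary input types along the encoder
  (`PolyTimeComputable.of_encode_eq`, `polyTimeComputable_fst_boolPair`);
* `PolyTimeComputable.comp_holds` (`TimeBoundsProofs.lean`): sequential composition of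
  polynomial-time machines (Mathlib's `proof_wanted Turing.TM2ComputableInPolyTime.comp`).

The coin budget of `RandAlg.ofDet f` is `coinLen = 0`, bounded by the zero polynomial.

## References

* S. Arora, B. Barak, *Computational Complexity: A Modern Approach*, CUP 2009, §7.1
  (Def. 7.1–7.3 and the remark "BPP clearly contains P" before Def. 7.3), §0.1 (pairing).
* J. Gill, *Computational complexity of probabilistic Turing machines*, SIAM J. Comput. 6
  (1977), §2, Prop. 5.1.
-/

namespace Literature.Computability.Complexity

open _root_.Computability

variable {α β α' β' Γ₀ Γ₁ : Type}

/-- **Re-encoding (transport) of polynomial-time computability.** `PolyTimeComputable ea eb f`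
only depends on the induced word map `ea a ↦ eb (f a)`: if `φ : α' → α` intertwines the
encoders, `ea (φ a') = ea' a'` and `eb (f (φ a')) = eb' (f' a')`, then the same machine and
the same polynomial witness `PolyTimeComputable ea' eb' f'`. (Same-machine transport, cf.
`PolyTimeComputable.precomp`/`.of_output_eq` in `NPBridge.lean` and
`PolyTimeComputable.of_comp_encode` in `MetaComplexity/HeuristicClassesProofs.lean`, neither
imported here to keep this file's imports to the two discharges it assembles.)
[folklore] -/
theorem PolyTimeComputable.of_encode_eq {ea : α → List Γ₀} {eb : β → List Γ₁} {f : α → β}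
    {ea' : α' → List Γ₀} {eb' : β' → List Γ₁} {f' : α' → β'} (φ : α' → α)
    (hea : ∀ a', ea (φ a') = ea' a') (heb : ∀ a', eb (f (φ a')) = eb' (f' a'))
    (h : PolyTimeComputable ea eb f) : PolyTimeComputable ea' eb' f' := by
  obtain ⟨p, M, hM⟩ := h
  refine ⟨p, M, fun a' => ?_⟩
  have h₁ : M.OutputsWithin (ea (φ a')) (eb (f (φ a'))) (p.eval (ea (φ a')).length) :=
    hM (φ a')
  rw [hea, heb] at h₁
  exact h₁

/-- **First projection under the pair presentation `p ↦ ⟨ea p.1, p.2⟩`.** For any encoder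
`ea : α → List Bool`, the projection `Prod.fst : α × List Bool → α` is polynomial-time
computable when the pair `(x, r)` is presented as `boolPair (ea x) r` and the output as `ea x`:
transport of `polyTimeComputable_fst_holds` (strings) along `p ↦ (ea p.1, p.2)`.
[Arora–Barak 2009, §0.1 (pairing), §1.2] [cite: AroraBarak2009, §0.1] -/
theorem polyTimeComputable_fst_boolPair (ea : α → List Bool) :
    PolyTimeComputable (fun p : α × List Bool => boolPair (ea p.1) p.2) ea
      (Prod.fst : α × List Bool → α) :=
  PolyTimeComputable.of_encode_eq (f := (Prod.fst : List Bool × List Bool → List Bool))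
    (fun p : α × List Bool => (ea p.1, p.2)) (fun _ => rfl) (fun _ => rfl)
    polyTimeComputable_fst_holds

namespace RandAlg

/-- **Discharge of `RandAlg.IsPolyTime.ofDet`** ("a deterministic TM is a special case of a
PTM … **BPP** clearly contains **P**"): if `f` is polynomial-time computable w.r.t. `ea`, `eb`,
then the coin-free randomized algorithm `RandAlg.ofDet f` is PPT — `uncurry (ofDet f).run =
f ∘ Prod.fst` is the composite (`PolyTimeComputable.comp_holds`) of the pair projection
(`polyTimeComputable_fst_boolPair ea`) with the given machine, and the coin budget
`coinLen = 0` is bounded by the zero polynomial.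
[Arora–Barak 2009, §7.1, remark before Def. 7.3; Gill 1977, Prop. 5.1]
[cite: AroraBarak2009, §7.1 (remark before Def. 7.3)] -/
theorem IsPolyTime.ofDet_holds : IsPolyTime.ofDet := by
  intro α β Γ₁ f ea eb hf
  refine ⟨?_, 0, fun n => Nat.zero_le _⟩
  exact PolyTimeComputable.comp_holds hf (polyTimeComputable_fst_boolPair ea)

end RandAlg

end Literature.Computability.Complexity
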